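import Mathlib.Analysis.SpecialFunctions.Log.Basic
import Mathlib.Analysis.SpecialFunctions.Pow.Real
import Mathlib.Topology.Order.Basic
import HarnessLib

/-!
# Port-cube tools: continuity of `Φ₄ = Q⁴/(A²B²)` where `A` may vanish, and the endpoint limits of the Case-1 chords

Support file for crux `stmt-CriticalPhenomena-4575` (`NoHeavyLowerTail`), seat `prim-l12-p1` gen 26 (`--supports stmt-CriticalPhenomena-4575`);
memo `run/shared/lean/prim/prim-l12/FROM-prim-l12-p1-g26-THEOREM-R-KERNEL.md`.  Pure real analysis (Mathlib only); no definitions, no sorries.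
Used by `…SuperTerminalQuarticOfMaxdir` (THEOREM R: `(MAXDIR) ⟹ V4`) together with `…PortCubeMaxPrinciple` and `…PortCubePhi4Line`:

* `continuous_sq_div`, `continuous_quartic_ratio` — if `Q, A, B` are continuous, `0 ≤ Q ≤ A` and `B > 0`, then `x ↦ Q⁴/(A²B²)` is continuous
  EVEN WHERE `A` VANISHES (there `Q = 0` and `Q⁴/(A²B²) = (Q²/A)²/B²` with `0 ≤ Q²/A ≤ Q → 0`; Lean's `x/0 = 0` is the continuous value).
  This is what makes the cube function `Φ₄ − I'_c` continuous on the CLOSED port cube, whose faces `r_i = 1` towards cut vertices of the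
  `s–a` routes have `I'_A = 0` (gen 25's paper proof treated those by a separate chord argument, which was flawed; see the memo);
* `tendsto_phi4Line_left_S`, `tendsto_phi4Line_left_b` — along a TERMINAL-type pair the line function
  `G(τ) = exp(4 log Q(τ) − 2 log A(τ) − 2 log B(τ)) − C(τ)` of `…PortCubePhi4Line` tends to `−C(1) ≤ 0` as `τ → 1⁻`:
  S-type `Q(τ) = (1−τ)Q₀`, `A(τ) = (1−τ)A₀`, `B(1) > 0`; b-type `Q(τ) = (1−τ)Q₀`, `B(τ) = (1−τ)B₀`, `A` constant;
* `card_filter_lt_of_subset_of_mem` — the induction measure drops (a strict sub-filter).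
-/

namespace Summit.CriticalPhenomena.PercolationContinuityZ3.Theorems.PortCubeTools

open Set Filter Topology Real

/-! ## Continuity of `Q⁴/(A²B²)` with `0 ≤ Q ≤ A`, `B > 0` -/

/-- If `Q, A` are continuous with `0 ≤ Q ≤ A` then `x ↦ Q²/A` is continuous (value `0` where `A = 0`, by `0 ≤ Q²/A ≤ Q`). [this work] -/
theorem continuous_sq_div {X : Type*} [TopologicalSpace X] {Q A : X → ℝ} (hQ : Continuous Q) (hA : Continuous A)
    (h0 : ∀ x, 0 ≤ Q x) (hQA : ∀ x, Q x ≤ A x) : Continuous fun x => Q x ^ 2 / A x := by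
  have hbd : ∀ x, 0 ≤ Q x ^ 2 / A x ∧ Q x ^ 2 / A x ≤ Q x := by
    intro x
    rcases eq_or_lt_of_le ((h0 x).trans (hQA x)) with hA0 | hApos
    · rw [← hA0, div_zero]; exact ⟨le_rfl, h0 x⟩
    · refine ⟨div_nonneg (sq_nonneg _) hApos.le, ?_⟩
      rw [div_le_iff₀ hApos, sq]
      exact mul_le_mul_of_nonneg_left (hQA x) (h0 x)
  refine continuous_iff_continuousAt.2 fun x₀ => ?_
  rcases eq_or_ne (A x₀) 0 with hA0 | hAne
  · -- squeeze: `0 ≤ Q²/A ≤ Q → Q x₀ = 0`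
    have hQ0 : Q x₀ = 0 := le_antisymm (hA0 ▸ hQA x₀) (h0 x₀)
    have hval : Q x₀ ^ 2 / A x₀ = 0 := by rw [hA0, div_zero]
    rw [ContinuousAt, hval]
    refine tendsto_of_tendsto_of_tendsto_of_le_of_le tendsto_const_nhds ?_ (fun x => (hbd x).1) (fun x => (hbd x).2)
    have := hQ.continuousAt (x := x₀)
    rw [ContinuousAt, hQ0] at this
    exact this
  · exact ((hQ.pow 2).continuousAt).div hA.continuousAt hAne

/-- **Continuity of `Φ₄`.**  If `Q, A, B` are continuous, `0 ≤ Q ≤ A` and `B > 0` everywhere, then `x ↦ Q⁴/(A²B²)` is continuous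
(`= (Q²/A)²/B²`, also at the zeros of `A`). [this work] -/
theorem continuous_quartic_ratio {X : Type*} [TopologicalSpace X] {Q A B : X → ℝ} (hQ : Continuous Q) (hA : Continuous A)
    (hB : Continuous B) (h0 : ∀ x, 0 ≤ Q x) (hQA : ∀ x, Q x ≤ A x) (hBpos : ∀ x, 0 < B x) :
    Continuous fun x => Q x ^ 4 / (A x ^ 2 * B x ^ 2) := by
  have heq : (fun x => Q x ^ 4 / (A x ^ 2 * B x ^ 2)) = fun x => (Q x ^ 2 / A x) ^ 2 / B x ^ 2 := by
    funext x
    rcases eq_or_ne (A x) 0 with hA0 | hAne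
    · have hQ0 : Q x = 0 := le_antisymm (hA0 ▸ hQA x) (h0 x)
      simp [hQ0]
    · field_simp
  rw [heq]
  exact ((continuous_sq_div hQ hA h0 hQA).pow 2).div (hB.pow 2) fun x => pow_ne_zero 2 (hBpos x).ne'

/-! ## Endpoint limits of the Case-1 chords (`τ → 1⁻`) -/

/-- **S-type terminal pair.**  With `Q(τ) = q₀ − τ q₀`, `A(τ) = a₀ − τ a₀` (`q₀, a₀ > 0`) and `B(τ) = b₀ − τ·db` with `b₀ − db > 0`:
`exp(4 log Q − 2 log A − 2 log B) − (c₀ − τ dc) → −(c₀ − dc)` as `τ → 1⁻` (the quartic `(1−τ)⁴` beats `(1−τ)²`). [this work] -/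
theorem tendsto_phi4Line_left_S {q₀ a₀ b₀ db c₀ dc : ℝ} (hq : 0 < q₀) (ha : 0 < a₀) (hb1 : 0 < b₀ - db) :
    Tendsto (fun τ : ℝ => exp (4 * log (q₀ - τ * q₀) - 2 * log (a₀ - τ * a₀) - 2 * log (b₀ - τ * db)) - (c₀ - τ * dc))
      (𝓝[<] (1 : ℝ)) (𝓝 (-(c₀ - dc))) := by
  -- the continuous model `H(τ) = (1−τ)² q₀⁴/(a₀² (b₀ − τ db)²) − (c₀ − τ dc)`
  set H : ℝ → ℝ := fun τ => (1 - τ) ^ 2 * q₀ ^ 4 / (a₀ ^ 2 * (b₀ - τ * db) ^ 2) - (c₀ - τ * dc) with hH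
  have hHc : ContinuousAt H 1 := by
    have hne : a₀ ^ 2 * (b₀ - 1 * db) ^ 2 ≠ 0 := by
      have : b₀ - 1 * db ≠ 0 := by rw [one_mul]; exact hb1.ne'
      positivity
    simp only [hH]
    fun_prop (disch := exact hne)
  have hH1 : H 1 = -(c₀ - dc) := by simp [hH]
  have hlim : Tendsto H (𝓝[<] (1 : ℝ)) (𝓝 (-(c₀ - dc))) := by
    rw [← hH1]; exact hHc.tendsto.mono_left nhdsWithin_le_nhds
  refine hlim.congr' ?_
  -- equality on a left neighbourhood of `1` where `b₀ − τ db > 0`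
  have hcont : ContinuousAt (fun τ : ℝ => b₀ - τ * db) 1 := by fun_prop
  have hpos : ∀ᶠ τ in 𝓝 (1 : ℝ), 0 < b₀ - τ * db :=
    hcont.eventually (eventually_gt_nhds (by simpa using hb1))
  have hlt : ∀ᶠ τ in 𝓝[<] (1 : ℝ), τ < 1 := eventually_nhdsWithin_of_forall fun τ hτ => hτ
  filter_upwards [hlt, hpos.filter_mono nhdsWithin_le_nhds] with τ hτ hbτ
  have h1 : 0 < 1 - τ := sub_pos.2 hτ
  have hqτ : q₀ - τ * q₀ = (1 - τ) * q₀ := by ring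
  have haτ : a₀ - τ * a₀ = (1 - τ) * a₀ := by ring
  have e : 4 * log (q₀ - τ * q₀) - 2 * log (a₀ - τ * a₀) - 2 * log (b₀ - τ * db) =
      ((4 : ℕ) : ℝ) * log ((1 - τ) * q₀) - (((2 : ℕ) : ℝ) * log ((1 - τ) * a₀) + ((2 : ℕ) : ℝ) * log (b₀ - τ * db)) := by
    rw [hqτ, haτ]; push_cast; ring
  simp only [hH]
  rw [e, exp_sub, exp_add, exp_nat_mul, exp_nat_mul, exp_nat_mul, exp_log (by positivity), exp_log (by positivity), exp_log hbτ]
  have hA : ((1 - τ) * a₀) ^ 2 ≠ 0 := by positivity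
  have hB : (b₀ - τ * db) ^ 2 ≠ 0 := by positivity
  field_simp

/-- **b-type terminal pair.**  With `Q(τ) = q₀ − τ q₀`, `B(τ) = b₀ − τ b₀` (`q₀, b₀ > 0`) and `A(τ) = a₀ − τ·0` constant (`a₀ > 0`):
`exp(4 log Q − 2 log A − 2 log B) − (c₀ − τ dc) → −(c₀ − dc)` as `τ → 1⁻`. [this work] -/
theorem tendsto_phi4Line_left_b {q₀ a₀ b₀ c₀ dc : ℝ} (hq : 0 < q₀) (ha : 0 < a₀) (hb : 0 < b₀) :
    Tendsto (fun τ : ℝ => exp (4 * log (q₀ - τ * q₀) - 2 * log (a₀ - τ * 0) - 2 * log (b₀ - τ * b₀)) - (c₀ - τ * dc))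
      (𝓝[<] (1 : ℝ)) (𝓝 (-(c₀ - dc))) := by
  set H : ℝ → ℝ := fun τ => (1 - τ) ^ 2 * q₀ ^ 4 / (a₀ ^ 2 * b₀ ^ 2) - (c₀ - τ * dc) with hH
  have hHc : ContinuousAt H 1 := by
    simp only [hH]
    fun_prop
  have hH1 : H 1 = -(c₀ - dc) := by simp [hH]
  have hlim : Tendsto H (𝓝[<] (1 : ℝ)) (𝓝 (-(c₀ - dc))) := by
    rw [← hH1]; exact hHc.tendsto.mono_left nhdsWithin_le_nhds
  refine hlim.congr' ?_
  have hlt : ∀ᶠ τ in 𝓝[<] (1 : ℝ), τ < 1 := eventually_nhdsWithin_of_forall fun τ hτ => hτ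
  filter_upwards [hlt] with τ hτ
  have h1 : 0 < 1 - τ := sub_pos.2 hτ
  have hqτ : q₀ - τ * q₀ = (1 - τ) * q₀ := by ring
  have hbτ : b₀ - τ * b₀ = (1 - τ) * b₀ := by ring
  have haτ : a₀ - τ * 0 = a₀ := by ring
  have e : 4 * log (q₀ - τ * q₀) - 2 * log (a₀ - τ * 0) - 2 * log (b₀ - τ * b₀) =
      ((4 : ℕ) : ℝ) * log ((1 - τ) * q₀) - (((2 : ℕ) : ℝ) * log a₀ + ((2 : ℕ) : ℝ) * log ((1 - τ) * b₀)) := by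
    rw [hqτ, hbτ, haτ]; push_cast; ring
  simp only [hH]
  rw [e, exp_sub, exp_add, exp_nat_mul, exp_nat_mul, exp_nat_mul, exp_log (by positivity), exp_log ha, exp_log (by positivity)]
  have hA : a₀ ^ 2 ≠ 0 := by positivity
  have hB : ((1 - τ) * b₀) ^ 2 ≠ 0 := by positivity
  field_simp

/-! ## The induction measure -/

/-- A strict sub-filter has smaller cardinality: if every `f` satisfying `p'` satisfies `p`, and some `f₀` satisfies `p` but not `p'`,
then `#{f | p' f} < #{f | p f}` (over a finite type). [folklore] -/
theorem card_filter_lt_of_subset_of_mem {ι : Type*} [Fintype ι] (p p' : ι → Prop) [DecidablePred p] [DecidablePred p']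
    (hsub : ∀ f, p' f → p f) {f₀ : ι} (h₀ : p f₀) (h₀' : ¬ p' f₀) :
    (Finset.univ.filter p').card < (Finset.univ.filter p).card := by
  refine Finset.card_lt_card ⟨?_, ?_⟩
  · intro f hf
    rw [Finset.mem_filter] at hf ⊢
    exact ⟨hf.1, hsub f hf.2⟩
  · intro hle
    have : f₀ ∈ Finset.univ.filter p' := hle (by rw [Finset.mem_filter]; exact ⟨Finset.mem_univ _, h₀⟩)
    rw [Finset.mem_filter] at this
    exact h₀' this.2

end Summit.CriticalPhenomena.PercolationContinuityZ3.Theorems.PortCubeTools
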